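import Mathlib.Data.Int.Basic
import Mathlib.Data.Nat.Log
import HarnessLib

/-!
# Sections of `ζ` beyond `σ = 1`: the certificate checker (computable core)

Barrier catalogue `Literature/Barriers/RiemannHypothesis/`, companion of `TuranPartialSums.lean`
(step (C) of the plan to prove `TuranPartialSums`). This file contains ONLY computable functions on
`ℕ`/`ℤ`, written for evaluation by the kernel (`decide +kernel`): the checker `check N W es` of the
`σ = 1` criterion `exists_zero_of_criterion` (`TuranPartialSumsCriterion.lean`) for a certificate
`es = [(p, x, y, d), …]` assigning the Gaussian-rational phase `ω(p) = (x + iy)/d` (`x² + y² = d²`)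
to each prime `p` of a set `S ⊇ {p : p² ≤ N}`. Its meaning (`check … = true →` `ζ_N` has a zero
with `Re s > 1`) is `TuranPartialSumsCheckSound.lean`. Nothing is asserted here.

## What is computed (all exact)

With `M = ∏_{(p,·,·,d) ∈ es} (dp)^{⌊log_p N⌋}` (a common denominator) and `a_ω` the completely
multiplicative extension of `ω`:
* in one pass over `j = 1, …, N` (`mainGo`): the Gaussian integer
  `B' = M · ∑_{j ≤ N, S-smooth} a_ω(j)/j` (`stripAll` divides the primes of `S` out of `j`,
  accumulating `∏ (x+iy)^{v_p}` and `∏ d^{v_p}`; `j` is `S`-smooth iff the cofactor is `1`; the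
  division `M/(∏ d^{v_p} · j)` is checked to be exact), its snapshots `L_k = M ∑_{m ≤ k} a_ω(m)/m`
  for `k ≤ K = ⌊√N⌋`, and for every `r ≤ N` out of which nothing is stripped (these are exactly the
  free primes `T = {p ≤ N prime} ∖ S`, all `> K`): `q_r = |L_{⌊N/r⌋}|²` and `s_r = ⌊√q_r⌋`
  (Newton's method, the result verified by `s_r² ≤ q_r < (s_r+1)²`), so that the radius
  `ρ_r = |c_r(1)| = |∑_{m ≤ N/r} a_ω(m)/(mr)|` satisfies `s_r ≤ M r ρ_r < s_r + 1`;
* `Rsum = ∑_r ⌊W s_r / r⌋ ≤ W M ∑_r ρ_r` and the largest ratio `(s_r + 1)/r = hn/hd`;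
* the verdict: `W² |B'|² < Rsum²` (giving `|B(1)| < ∑ ρ_r`) and `2 W hn ≤ Rsum · hd` (giving
  `2ρ_r < ∑ ρ` for every free `r`), after the sanity checks `validEntries` (each `p` prime by trial
  division, keys increasing, `x² + y² = d² > 0`) and `smallPrimesIn` (every `p ≥ 2` with `p² ≤ N`
  is a key or has a key divisor, whence every prime `p` with `p² ≤ N` is a key).

Arithmetic is by the kernel-accelerated `Nat.*` primitives and `Int` (componentwise Gaussian
arithmetic); loops are tail-recursive on explicit fuel.

## References

* [PlattTrudgian2016] D. J. Platt, T. S. Trudgian, LMS J. Comput. Math. 19 (2016), §2 (interval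
  arithmetic over the phases `θ_p`; here replaced by exact arithmetic at `σ = 1`).
-/

namespace Literature.Barriers.RiemannHypothesis.TuranCheck

/-! ### Trial division, integer square root, integer logarithm -/

/-- Trial division loop: `true` iff no `d' ∈ [d, …)` with `d'² ≤ p` divides `p` (fuel-bounded).
[folklore] -/
def tdGo (p : ℕ) : ℕ → ℕ → Bool
  | 0, _ => false
  | fuel + 1, d =>
    bif Nat.blt p (Nat.mul d d) then true
    else bif Nat.beq (Nat.mod p d) 0 then false
    else tdGo p fuel (Nat.add d 1)

/-- Primality by trial division (sound: `isPrimeTD_sound`). [folklore] -/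
def isPrimeTD (p : ℕ) : Bool :=
  Nat.ble 2 p && tdGo p p 2

/-- Newton iteration for `⌊√q⌋` from above (a candidate only; verified where used). [folklore] -/
def isqrtGo (q : ℕ) : ℕ → ℕ → ℕ
  | 0, g => g
  | fuel + 1, g =>
    let g' := Nat.div (Nat.add g (Nat.div q g)) 2
    bif Nat.blt g' g then isqrtGo q fuel g' else g

/-- Candidate integer square root. [folklore] -/
def isqrt (q : ℕ) : ℕ :=
  bif Nat.beq q 0 then 0
  else isqrtGo q 400 (Nat.shiftLeft 1 (Nat.add (Nat.div (Nat.log2 q) 2) 1))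

/-- Largest `e ≤ fuel` with `p^e ≤ N` (for `p ≥ 2`, `N ≥ 1`), computed upward. [folklore] -/
def ilogGo (p N : ℕ) : ℕ → ℕ → ℕ → ℕ
  | 0, e, _ => e
  | fuel + 1, e, pe =>
    let pe' := Nat.mul pe p
    bif Nat.ble pe' N then ilogGo p N fuel (Nat.add e 1) pe' else e

/-! ### Stripping the primes of `S` -/

/-- Strip every key of the certificate out of `m`, in order: at the head entry `(p, x, y, d)`,
divide by `p` (multiplying the Gaussian numerator `gr + i gi` by `x + iy` and the denominator `D` by
`d`) while `p ∣ m`, then pass to the next entry; at most `fuel` steps in all (exhaustion is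
signalled by the cofactor `0`). Returns the cofactor and the accumulated `(gr, gi, D)`.
[folklore] -/
def stripGo : ℕ → List (ℕ × ℤ × ℤ × ℕ) → ℕ → ℤ → ℤ → ℕ → ℕ × ℤ × ℤ × ℕ
  | 0, _, _, gr, gi, D => (0, gr, gi, D)
  | _ + 1, [], m, gr, gi, D => (m, gr, gi, D)
  | fuel + 1, (p, x, y, d) :: es, m, gr, gi, D =>
    bif Nat.beq (Nat.mod m p) 0 then
      stripGo fuel ((p, x, y, d) :: es) (Nat.div m p) (Int.sub (Int.mul gr x) (Int.mul gi y))
        (Int.add (Int.mul gr y) (Int.mul gi x)) (Nat.mul D d)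
    else stripGo fuel es m gr gi D

/-- Strip every key out of `m` starting from `(gr + i gi)/D = 1` (fuel `128 ≥ #keys + ∑ v_p(m)` is
checked to suffice where used). [folklore] -/
def stripAll (es : List (ℕ × ℤ × ℤ × ℕ)) (m : ℕ) : ℕ × ℤ × ℤ × ℕ :=
  stripGo 128 es m 1 0 1

/-- `true` iff `p` is a key of the certificate. [folklore] -/
def isKey : List (ℕ × ℤ × ℤ × ℕ) → ℕ → Bool
  | [], _ => false
  | (q, _, _, _) :: es, p => bif Nat.beq p q then true else isKey es p

/-- `true` iff some key of the certificate divides `p`. [folklore] -/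
def keyDvd : List (ℕ × ℤ × ℤ × ℕ) → ℕ → Bool
  | [], _ => false
  | (q, _, _, _) :: es, p => bif Nat.beq (Nat.mod p q) 0 then true else keyDvd es p

/-! ### The main loop over `j = 1, …, N` -/

/-- `|z|²` of a Gaussian integer. [folklore] -/
def normSq (zr zi : ℤ) : ℕ :=
  Nat.add (Nat.mul (Int.natAbs zr) (Int.natAbs zr)) (Nat.mul (Int.natAbs zi) (Int.natAbs zi))

/-- One step of the main loop at `j`, on the state `(Bre, Bim, Lrev, Rsum, hn, hd)`:
* if `j` is `S`-smooth (cofactor `1`): add `(∏ (x+iy)^{v_p}) · M/((∏ d^{v_p}) j)` to the Gaussian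
  integer `Bre + i Bim` (failing if the division is not exact) and, while `j ≤ K`, record the new
  value in front of the list of snapshots `Lrev`;
* a non-smooth `j ≤ K` is a failure;
* if nothing was stripped (`j` is a free prime `r > K`): with the snapshot
  `L = M ∑_{m ≤ N/r} a_ω(m)/m` (position `K − N/r` of `Lrev`), `q = |L|²`, `s = ⌊√q⌋` (candidate
  `isqrt`, verified), add
  `⌊W s / r⌋` to `Rsum` and update the maximal ratio `hn/hd ≥ (s+1)/r`;
* otherwise (`j` composite with a free prime factor) do nothing.
[folklore] -/
def mainStep (N W K M : ℕ) (es : List (ℕ × ℤ × ℤ × ℕ)) (j : ℕ) (Bre Bim : ℤ)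
    (Lrev : List (ℤ × ℤ)) (Rsum hn hd : ℕ) : Option (ℤ × ℤ × List (ℤ × ℤ) × ℕ × ℕ × ℕ) :=
  match stripAll es j with
  | (m, gr, gi, D) =>
    bif Nat.beq m 0 then none
    else bif Nat.beq m 1 then
      let Dn := Nat.mul D j
      bif Nat.beq (Nat.mod M Dn) 0 then
        let t : ℤ := Int.ofNat (Nat.div M Dn)
        let Bre' := Int.add Bre (Int.mul gr t)
        let Bim' := Int.add Bim (Int.mul gi t)
        some (Bre', Bim', (bif Nat.ble j K then (Bre', Bim') :: Lrev else Lrev), Rsum, hn, hd)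
      else none
    else bif Nat.ble j K then none
    else bif Nat.beq m j then
      match List.getD Lrev (Nat.sub K (Nat.div N j)) ((0 : ℤ), (0 : ℤ)) with
      | (lr, li) =>
        let q := normSq lr li
        let s := isqrt q
        bif Nat.ble (Nat.mul s s) q && Nat.blt q (Nat.mul (Nat.add s 1) (Nat.add s 1)) then
          let Rsum' := Nat.add Rsum (Nat.div (Nat.mul W s) j)
          bif Nat.blt (Nat.mul hn j) (Nat.mul (Nat.add s 1) hd) then
            some (Bre, Bim, Lrev, Rsum', Nat.add s 1, j)
          else some (Bre, Bim, Lrev, Rsum', hn, hd)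
        else none
    else some (Bre, Bim, Lrev, Rsum, hn, hd)

/-- The main loop over `j, j+1, …, j+fuel−1` (tail-recursive). [folklore] -/
def mainGo (N W K M : ℕ) (es : List (ℕ × ℤ × ℤ × ℕ)) :
    ℕ → ℕ → ℤ → ℤ → List (ℤ × ℤ) → ℕ → ℕ → ℕ → Option (ℤ × ℤ × List (ℤ × ℤ) × ℕ × ℕ × ℕ)
  | 0, _, Bre, Bim, Lrev, Rsum, hn, hd => some (Bre, Bim, Lrev, Rsum, hn, hd)
  | fuel + 1, j, Bre, Bim, Lrev, Rsum, hn, hd =>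
    match mainStep N W K M es j Bre Bim Lrev Rsum hn hd with
    | none => none
    | some (Bre', Bim', Lrev', Rsum', hn', hd') =>
      mainGo N W K M es fuel (Nat.add j 1) Bre' Bim' Lrev' Rsum' hn' hd'

/-! ### Sanity checks and the verdict -/

/-- Every entry `(p, x, y, d)` has `p` prime, `x² + y² = d²`, `d > 0`, and the keys increase
strictly (`prev` = previous key). [folklore] -/
def validGo : List (ℕ × ℤ × ℤ × ℕ) → ℕ → Bool
  | [], _ => true
  | (p, x, y, d) :: es, prev =>
    Nat.blt prev p && isPrimeTD p && Nat.blt 0 d &&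
      (Int.add (Int.mul x x) (Int.mul y y) == Int.mul (Int.ofNat d) (Int.ofNat d)) &&
      validGo es p

/-- Validity of the whole certificate. [folklore] -/
def validEntries (es : List (ℕ × ℤ × ℤ × ℕ)) : Bool :=
  validGo es 0

/-- Every `p' ≥ p` with `p'² ≤ N` is a key or is divisible by a key (so that, the keys being
primes, every prime `p'` with `p'² ≤ N` is a key); fuel-bounded upward loop. [folklore] -/
def spGo (N : ℕ) (es : List (ℕ × ℤ × ℤ × ℕ)) : ℕ → ℕ → Bool
  | 0, p => Nat.blt N (Nat.mul p p)
  | fuel + 1, p =>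
    bif Nat.blt N (Nat.mul p p) then true
    else (isKey es p || keyDvd es p) && spGo N es fuel (Nat.add p 1)

/-- `S ⊇ {p prime : p² ≤ N}`. [folklore] -/
def smallPrimesIn (N : ℕ) (es : List (ℕ × ℤ × ℤ × ℕ)) : Bool :=
  spGo N es N 2

/-- The common denominator `M = ∏ (d p)^{⌊log_p N⌋}`. [folklore] -/
def bigM (N : ℕ) : List (ℕ × ℤ × ℤ × ℕ) → ℕ
  | [] => 1
  | (p, _, _, d) :: es => Nat.mul (Nat.pow (Nat.mul d p) (ilogGo p N 64 0 1)) (bigM N es)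

/-- **The checker.** `check N W es = true` certifies the hypotheses of `exists_zero_of_criterion`
for the phases `es` (soundness: `TuranPartialSumsCheckSound`); `W` is the fixed-point scale of the
radii, `K = ⌊√N⌋` (computed and verified). [cite: PlattTrudgian2016, §2.2] -/
def check (N W : ℕ) (es : List (ℕ × ℤ × ℤ × ℕ)) : Bool :=
  let K := isqrt N
  validEntries es && smallPrimesIn N es && Nat.ble (Nat.mul K K) N &&
    Nat.blt N (Nat.mul (Nat.add K 1) (Nat.add K 1)) &&
    (match mainGo N W K (bigM N es) es N 1 0 0 [] 0 0 1 with
     | none => false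
     | some (Bre, Bim, _, Rsum, hn, hd) =>
       Nat.blt (Nat.mul (Nat.mul W W) (normSq Bre Bim)) (Nat.mul Rsum Rsum) &&
         Nat.ble (Nat.mul (Nat.mul 2 W) hn) (Nat.mul Rsum hd))

/-- The checker over a range: `check n W es` for all `n ∈ [n₀, n₀ + len)`. [folklore] -/
def checkRange (W : ℕ) (es : List (ℕ × ℤ × ℤ × ℕ)) : ℕ → ℕ → Bool
  | 0, _ => true
  | len + 1, n₀ => check n₀ W es && checkRange W es len (Nat.add n₀ 1)

/-- The checker over a list of segments `(n₀, len, es)`. [folklore] -/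
def checkSegs (W : ℕ) : List (ℕ × ℕ × List (ℕ × ℤ × ℤ × ℕ)) → Bool
  | [] => true
  | (n₀, len, es) :: segs => checkRange W es len n₀ && checkSegs W segs

/-- The segments `(n₀, len, es)` tile `[cur, hi)` consecutively (so every `N ∈ [cur, hi)` lies in
one of them). [folklore] -/
def coversGo : List (ℕ × ℕ × List (ℕ × ℤ × ℤ × ℕ)) → ℕ → ℕ → Bool
  | [], cur, hi => Nat.ble hi cur
  | (n₀, len, _) :: segs, cur, hi => Nat.beq n₀ cur && coversGo segs (Nat.add cur len) hi

end Literature.Barriers.RiemannHypothesis.TuranCheck
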